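import Literature.Barriers.AnomalousDissipation.VortexSheetSubsolutionWeak
import HarnessLib

/-!
# Székelyhidi's vortex-sheet theorem (Thm. 1.1) from his localized convex-integration theorem
  (Thm. 1.3): the assembly `Szekelyhidi2011_thm11_of_thm13`

Topic `Barriers/AnomalousDissipation`, last layer of the reduction of the named fact
`Literature.Barriers.AnomalousDissipation.Szekelyhidi2011_thm11` (Székelyhidi, C. R. Math. 349
(2011) 1063–1066, Thm. 1.1: infinitely many admissible weak Euler solutions with the flat
vortex-sheet datum, infinitely many conserving the energy, infinitely many strictly dissipating;
`ShearFlowViscositySelectionWild.lean`) to the convex-integration fact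
`Literature.Analysis.FluidPDE.Torus.Szekelyhidi2011_thm13` (op. cit. Thm. 1.3 = De Lellis–
Székelyhidi 2010, Prop. 2, localized; `EulerSubsolutionCriterion.lean`), following the printed proof
(op. cit. Thm. 1.4 and §2) with the explicit subsolution of `VortexSheetSubsolution.lean`,
`VortexSheetBurgers.lean`, `VortexSheetSubsolutionWeak.lean`. Everything here is proved; there
are no definitions and no new named facts. With this file the barrier statement
`BardosTitiWiedemann2012_cor2` (Bardos–Titi–Wiedemann 2012, Cor. 2;
`ShearFlowViscositySelectionSzekelyhidi.lean`) rests on the single named fact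
`Torus.Szekelyhidi2011_thm13`.

Székelyhidi 2011, after Thm. 1.3: "In particular, if `v := v̄ + ṽ` in the above theorem, then `v`
satisfies the incompressible Euler equations in the space–time region `U` with pressure `p`,
where `½|v|² = ē`, `p = q̄ - (2/n) ē` (7)"; §2: "With this choice of `U` and `ē` the triple
`(v̄, ū, q̄)` satisfies (8) for all time. Therefore, with Theorem 1.4 we conclude the proof …
The kinetic energy is given by `E(t) = ∫ ē dx` … `dE/dt = -ε (2/3) λ (1 - λ)` (12)."

## Contents

* `VortexSheet.ae_prod_norm_le_of_forall_ae` — every-slice `L^∞` bounds of a jointly measurable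
  field give a space–time `L^∞` bound (Fubini on a measurable modification).
* `VortexSheet.sum_mul_inner_eq_of_vecMulVec_eq` — the pointwise algebra of (7): if
  `v ⊗ v = ū + ũ + ē Id` and `div ψ = 0` then `⟪v, (v·∇)ψ⟫ = ū : ∇ψ + ũ : ∇ψ`.
* `VortexSheet.weakIdentity_vbar_add` — **the weak Euler identity of `v = v̄ + ṽ` with datum
  `v₀`** on `T² × [0, T)`, `T ≤ 1`, from the momentum identity of the subsolution
  (`VortexSheet.momentum_identity_of_le_one`), the linear system of `(ṽ, ũ, 0)` and the
  constitutive identity a.e. (bookkeeping: `TorusWeakFormBookkeeping`).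
* `VortexSheet.ae_norm_sq_eq_two_mul_ebar`, `lintegral_enorm_sq_vbar_add(_of_mem_Icc)` — the
  prescribed energy `½|v(t)|² = ē(t)` a.e. on every slice and `∫|v(t)|² = 1 - εt/3` on `[0, ½]`;
  `vbar_add_zero_ae_eq` (`v(0) = v₀` a.e.), `memLp_top_stLift_vbar_add` (`v ∈ L^∞`),
  `isWeaklyDivFree_vbar_add`, `continuous_integral_inner_vbar_add`.
* `Szekelyhidi2011_thm11_of_thm13` — **Thm. 1.1 from Thm. 1.3**: on `T² × [0, ½]`, the family
  `v_{ε,c} = v̄ + ṽ_{ε,c}` over `ε = 0`, `c ∈ (-1, 1)` (energy conserving; distinct by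
  `VortexSheet.eq_of_ebar_zero_ae_eq`) and `ε ∈ (0, 1)`, `c = 0` (energy `1 - εt/3`, strictly
  decreasing) consists of infinitely many admissible weak Euler solutions with datum `v₀`,
  bounded, pairwise not a.e. equal on the slice `t = ½`.

## References

* L. Székelyhidi Jr., C. R. Math. Acad. Sci. Paris 349 (2011) 1063–1066, Thm. 1.1, Def. 1.2,
  Thm. 1.3, Thm. 1.4, §2, (3), (6)–(8), (12) (`Szekelyhidi2011`).
* C. De Lellis, L. Székelyhidi Jr., Arch. Ration. Mech. Anal. 195 (2010) 225–260, Prop. 2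
  (`DeLellisSzekelyhidi2010`).
* C. Bardos, E. S. Titi, E. Wiedemann, C. R. Math. Acad. Sci. Paris 350 (2012) 757–760, Thm. 1,
  Cor. 2 (`BardosTitiWiedemann2012`).
-/

open MeasureTheory Set Filter Function intervalIntegral
open scoped InnerProductSpace ContDiff ENNReal
open Literature.Analysis.FunctionSpaces
open Literature.Analysis.FunctionSpaces.Torus (stLift timeDeriv IsWeaklyDivFree IsSpaceTimeTest
  IsSpaceTimeTestIoo IsDivFreeTest IsSmooth IsContDiff proj lift liftAt axisAvg divergence partialDeriv
  convect axisAvg_apply axisAvg_add_single proj_smul_single integral_inner_eq_integral_inner_axisAvg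
  integrable_inner_shift_of_bound)
open Literature.Analysis.FluidPDE.Torus (IsEulerSubsolutionOn)

noncomputable section

namespace Literature.Barriers.AnomalousDissipation

namespace VortexSheet


section WildHelpers

/-- **From every-slice bounds to a space–time bound**: if `w` is jointly a.e. strongly measurable
on `ℝ × T²` and `‖w(t, ·)‖ ≤ C` a.e. for every `t`, then `‖w‖ ≤ C` a.e. on `ℝ × T²` (Fubini for the
super-level set of a measurable modification). [folklore] -/
theorem ae_prod_norm_le_of_forall_ae {w : ℝ → (UnitAddTorus (Fin 2)) → (EuclideanSpace ℝ (Fin 2))} {C : ℝ}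
    (hwm : AEStronglyMeasurable (uncurry w) (volume : Measure (ℝ × (UnitAddTorus (Fin 2)))))
    (hb : ∀ t, ∀ᵐ x : (UnitAddTorus (Fin 2)), ‖w t x‖ ≤ C) :
    ∀ᵐ p : ℝ × (UnitAddTorus (Fin 2)), ‖w p.1 p.2‖ ≤ C := by
  set g : ℝ × (UnitAddTorus (Fin 2)) → (EuclideanSpace ℝ (Fin 2)) := hwm.mk (uncurry w) with hg_def
  have hg : StronglyMeasurable g := hwm.stronglyMeasurable_mk
  have hae : uncurry w =ᵐ[volume] g := hwm.ae_eq_mk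
  have hae' : ∀ᵐ t : ℝ, ∀ᵐ x : (UnitAddTorus (Fin 2)), uncurry w (t, x) = g (t, x) := by
    rw [Measure.volume_eq_prod] at hae
    exact Measure.ae_ae_of_ae_prod hae
  have hN : MeasurableSet {p : ℝ × (UnitAddTorus (Fin 2)) | C < ‖g p‖} :=
    measurableSet_lt measurable_const hg.measurable.norm
  have hnull : volume {p : ℝ × (UnitAddTorus (Fin 2)) | C < ‖g p‖} = 0 := by
    rw [Measure.volume_eq_prod, Measure.prod_apply hN]
    have h0 : ∀ᵐ t : ℝ, (volume : Measure (UnitAddTorus (Fin 2)))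
        (Prod.mk t ⁻¹' {p : ℝ × (UnitAddTorus (Fin 2)) | C < ‖g p‖}) = 0 := by
      filter_upwards [hae'] with t ht
      refine measure_eq_zero_iff_ae_notMem.2 ?_
      filter_upwards [ht, hb t] with x hx hxb
      simp only [mem_preimage, mem_setOf_eq, not_lt]
      rw [← hx]
      exact hxb
    rw [lintegral_congr_ae h0, lintegral_zero]
  have h1 : ∀ᵐ p : ℝ × (UnitAddTorus (Fin 2)), ‖g p‖ ≤ C := by
    rw [ae_iff]
    simpa [not_le] using hnull
  filter_upwards [h1, hae] with p hp hpe
  have : ‖w p.1 p.2‖ = ‖uncurry w p‖ := rfl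
  rw [this, hpe]
  exact hp

/-- Components of spatial derivatives of a space–time test field are jointly continuous. [folklore] -/
theorem continuous_uncurry_fderiv_apply {T : ℝ} {ψ : ℝ → (UnitAddTorus (Fin 2)) → (EuclideanSpace ℝ (Fin 2))}
    (hψ : IsSpaceTimeTest T ψ) (j i : Fin 2) :
    Continuous (uncurry fun t x => Torus.fderiv (ψ t) x (EuclideanSpace.single j 1) i) := by
  have h2 := hψ.continuous_uncurry_lineDeriv (EuclideanSpace.single j 1)
  have h3 : (uncurry fun t x => Torus.fderiv (ψ t) x (EuclideanSpace.single j 1) i) =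
      (EuclideanSpace.proj i : EuclideanSpace ℝ (Fin 2) →L[ℝ] ℝ) ∘
        (uncurry fun t x => Torus.lineDeriv (ψ t) x (EuclideanSpace.single j 1)) := by
    funext p
    simp only [Function.comp_apply, uncurry]
    rw [Torus.lineDeriv_eq_fderiv_apply ((hψ.isSmooth_slice p.1).isContDiff (by simp))]
    rfl
  rw [h3]
  exact (EuclideanSpace.proj i : EuclideanSpace ℝ (Fin 2) →L[ℝ] ℝ).continuous.comp h2

/-- A common bound for the components of the spatial derivatives of a space–time test field on
`[0, T] × T²`. [folklore] -/
theorem exists_bound_fderiv_apply {T : ℝ} {ψ : ℝ → (UnitAddTorus (Fin 2)) → (EuclideanSpace ℝ (Fin 2))}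
    (hψ : IsSpaceTimeTest T ψ) :
    ∃ M : ℝ, 0 ≤ M ∧ ∀ t ∈ Icc (0 : ℝ) T, ∀ x, ∀ j i : Fin 2,
      |Torus.fderiv (ψ t) x (EuclideanSpace.single j 1) i| ≤ M := by
  obtain ⟨M, hM0, hM⟩ := hψ.exists_bound_sum_partialDeriv (isCompact_Icc (a := (0 : ℝ)) (b := T))
  refine ⟨M, hM0, fun t ht x j i => ?_⟩
  have hC1 : IsContDiff 1 (ψ t) := (hψ.isSmooth_slice t).isContDiff (by simp)
  have h1 : |Torus.fderiv (ψ t) x (EuclideanSpace.single j 1) i| ≤ ‖partialDeriv j (ψ t) x‖ := by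
    rw [← Torus.partialDeriv_eq_fderiv_apply hC1, ← Real.norm_eq_abs]
    exact PiLp.norm_apply_le (p := 2) (partialDeriv j (ψ t) x) i
  refine h1.trans ((Finset.single_le_sum (f := fun j => ‖partialDeriv j (ψ t) x‖)
    (fun j _ => norm_nonneg _) (Finset.mem_univ j)).trans (hM t ht x))

/-- **The convective algebra** (the pointwise heart of "`v = v̄ + ṽ` satisfies the Euler
equations with pressure `p = q̄ - ē`", Székelyhidi 2011, (7)): if `v ⊗ v = M_u + M_z + e Id` and
`∑ᵢ Fᵢᵢ = 0` (a divergence-free test field), then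
`∑ⱼ vⱼ ⟪v, Fⱼ⟫ = ∑ᵢⱼ (M_u)ᵢⱼ Fⱼᵢ + ∑ᵢⱼ (M_z)ᵢⱼ Fⱼᵢ` — the isotropic part `e Id` pairs to zero.
[cite: Szekelyhidi2011, (6)–(7)] -/
theorem sum_mul_inner_eq_of_vecMulVec_eq {v : (EuclideanSpace ℝ (Fin 2))} {Mu Mz : Matrix (Fin 2) (Fin 2) ℝ} {e : ℝ}
    {F : Fin 2 → (EuclideanSpace ℝ (Fin 2))} (hF : ∑ i, F i i = 0)
    (h : Matrix.vecMulVec v v = Mu + Mz + e • (1 : Matrix (Fin 2) (Fin 2) ℝ)) :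
    ∑ j, v j * ⟪v, F j⟫_ℝ = (∑ i, ∑ j, Mu i j * F j i) + ∑ i, ∑ j, Mz i j * F j i := by
  have hij : ∀ i j : Fin 2, v i * v j = Mu i j + Mz i j + e * (1 : Matrix (Fin 2) (Fin 2) ℝ) i j := by
    intro i j
    have := congrFun (congrFun h i) j
    simpa [Matrix.vecMulVec_apply, Matrix.add_apply, Matrix.smul_apply] using this
  have h00 := hij 0 0
  have h01 := hij 0 1
  have h10 := hij 1 0
  have h11 := hij 1 1
  simp only [Matrix.one_apply_eq, Matrix.one_apply_ne (ne_of_beq_false rfl : (0 : Fin 2) ≠ 1),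
    Matrix.one_apply_ne (ne_of_beq_false rfl : (1 : Fin 2) ≠ 0), mul_one, mul_zero, add_zero] at h00 h01 h10 h11
  rw [Fin.sum_univ_two] at hF
  simp only [Fin.sum_univ_two, EuclideanSpace.inner_eq_star_dotProduct, dotProduct, star_trivial]
  linear_combination (F 0 0) * h00 + (F 1 0) * h01 + (F 0 1) * h10 + (F 1 1) * h11 + e * hF

end WildHelpers


/-! ## The weak Euler identity of `v = v̄ + ṽ` -/

section WeakIdentity

variable {ε c C T : ℝ} {w : ℝ → (UnitAddTorus (Fin 2)) → (EuclideanSpace ℝ (Fin 2))}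
  {z : ℝ → (UnitAddTorus (Fin 2)) → Matrix (Fin 2) (Fin 2) ℝ}

/-- The product measure on `(0, T) × T²` is the restriction of the space–time volume. [folklore] -/
theorem restrict_prod_volume_eq (T : ℝ) :
    (volume.restrict (Ioo (0 : ℝ) T)).prod (volume : Measure (UnitAddTorus (Fin 2))) =
      (volume : Measure (ℝ × UnitAddTorus (Fin 2))).restrict (Ioo (0 : ℝ) T ×ˢ univ) := by
  rw [Measure.volume_eq_prod]
  exact Measure.restrict_prod_eq_prod_univ _

/-- The product measure on `(0, T) × T²` is finite. [folklore] -/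
theorem isFiniteMeasure_restrict_prod_volume (T : ℝ) :
    IsFiniteMeasure ((volume.restrict (Ioo (0 : ℝ) T)).prod (volume : Measure (UnitAddTorus (Fin 2)))) := by
  haveI : Fact (volume (Ioo (0 : ℝ) T) < ⊤) := ⟨measure_Ioo_lt_top⟩
  infer_instance

/-- Bounded a.e. and a.e. strongly measurable functions on `(0,T) × T²` are integrable. [folklore] -/
theorem integrable_prod_of_norm_le {G : ℝ × UnitAddTorus (Fin 2) → ℝ} {T M : ℝ}
    (hGm : AEStronglyMeasurable G ((volume.restrict (Ioo (0 : ℝ) T)).prod (volume : Measure (UnitAddTorus (Fin 2)))))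
    (hGb : ∀ᵐ p ∂((volume.restrict (Ioo (0 : ℝ) T)).prod (volume : Measure (UnitAddTorus (Fin 2)))), ‖G p‖ ≤ M) :
    Integrable G ((volume.restrict (Ioo (0 : ℝ) T)).prod (volume : Measure (UnitAddTorus (Fin 2)))) := by
  haveI := isFiniteMeasure_restrict_prod_volume T
  exact memLp_one_iff_integrable.1 (MemLp.of_bound hGm M hGb)

/-- The uniform `L²` bound of the perturbation slices from the every-slice `L^∞` bound. [folklore] -/
theorem integral_norm_sq_le_of_ae_bound {t : ℝ} (hw2 : MemLp (w t) 2 volume)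
    (hwC : ∀ᵐ x : UnitAddTorus (Fin 2), ‖w t x‖ ≤ C) : ∫ x, ‖w t x‖ ^ 2 ≤ C ^ 2 := by
  have hint : Integrable (fun x => ‖w t x‖ ^ 2) volume := hw2.integrable_norm_pow two_ne_zero
  calc ∫ x, ‖w t x‖ ^ 2 ≤ ∫ _ : UnitAddTorus (Fin 2), C ^ 2 := by
        refine integral_mono_ae hint (integrable_const _) ?_
        filter_upwards [hwC] with x hx
        have h0 : 0 ≤ ‖w t x‖ := norm_nonneg _
        nlinarith
    _ = C ^ 2 := by simp

/-- **The weak Euler identity of `v = v̄ + ṽ` with datum `v₀`** (the deduction of Thm. 1.1 /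
Thm. 1.4 from Thm. 1.3 in Székelyhidi 2011: "if `v := v̄ + ṽ` … then `v` satisfies the
incompressible Euler equations in the space–time region `U` with pressure `p = q̄ - (2/n)ē`",
(6)–(7), together with (3) for `(v̄, ū, q̄)` — `momentum_identity_of_le_one` — and for
`(ṽ, ũ, 0)`, and (8) off `U`). For a divergence-free space–time test field `ψ` on `[0,T)`,
`T ≤ 1`: `∫₀ᵀ∫ [⟪v, ∂ₜψ⟫ + ⟪v, (v·∇)ψ⟫] + ∫ ⟪v₀, ψ(0)⟫ = 0`. Pointwise a.e.,
`v ⊗ v = ū + ũ + ē Id` (`sum_mul_inner_eq_of_vecMulVec_eq`: the isotropic part pairs to zero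
against `∇ψ`, `div ψ = 0`, and so does `q̄`). [cite: Szekelyhidi2011, Thm. 1.3–1.4, (6)–(8)] -/
theorem weakIdentity_vbar_add (hT1 : T ≤ 1)
    (hwm : AEStronglyMeasurable (uncurry w) (volume : Measure (ℝ × UnitAddTorus (Fin 2))))
    (hzm : ∀ i j, AEStronglyMeasurable (fun p : ℝ × UnitAddTorus (Fin 2) => z p.1 p.2 i j) volume)
    (hwC : ∀ t, ∀ᵐ x : UnitAddTorus (Fin 2), ‖w t x‖ ≤ C)
    (hzC : ∀ i j, ∀ᵐ p : ℝ × UnitAddTorus (Fin 2), |z p.1 p.2 i j| ≤ C)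
    (hw2 : ∀ t, MemLp (w t) 2 volume)
    (hlin : ∀ φ : ℝ → UnitAddTorus (Fin 2) → EuclideanSpace ℝ (Fin 2), ContDiff ℝ ∞ (stLift φ) →
      ∫ t in Ioo (0 : ℝ) 1, ∫ x, (⟪w t x, timeDeriv φ t x⟫_ℝ +
        ∑ i, ∑ j, z t x i j * Torus.fderiv (φ t) x (EuclideanSpace.single j 1) i) = 0)
    (hoff : ∀ᵐ p : ℝ × UnitAddTorus (Fin 2), p ∉ U → w p.1 p.2 = 0 ∧ z p.1 p.2 = 0)
    (h6 : ∀ᵐ p : ℝ × UnitAddTorus (Fin 2), p ∈ U →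
      Matrix.vecMulVec (vbar p.1 p.2 + w p.1 p.2) (vbar p.1 p.2 + w p.1 p.2) -
        (ubar p.1 p.2 + z p.1 p.2) = (ebar ε c p.1 p.2) • (1 : Matrix (Fin 2) (Fin 2) ℝ))
    {ψ : ℝ → UnitAddTorus (Fin 2) → EuclideanSpace ℝ (Fin 2)} (hψ : IsSpaceTimeTest T ψ) (hdiv : IsDivFreeTest ψ) :
    (∫ t in Ioo (0 : ℝ) T, ∫ x, (⟪vbar t x + w t x, timeDeriv ψ t x⟫_ℝ +
        ⟪vbar t x + w t x, convect (fun y => vbar t y + w t y) (ψ t) x⟫_ℝ +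
        (0 : ℝ) * ⟪vbar t x + w t x, Torus.laplacian (ψ t) x⟫_ℝ)) +
      ∫ x, ⟪vortexSheetData x, ψ 0 x⟫_ℝ = 0 := by
  have hψ1 : IsSpaceTimeTest 1 ψ := IsSpaceTimeTest.of_le hψ hT1
  obtain ⟨M, hM0, hM⟩ := exists_bound_fderiv_apply hψ
  have hIo : ∀ {t : ℝ}, t ∈ Ioo (0 : ℝ) T → t ∈ Icc (0 : ℝ) T := fun ht => Ioo_subset_Icc_self ht
  -- measurability on `(0,T) × T²`
  have hvbm : AEStronglyMeasurable (uncurry vbar)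
      ((volume.restrict (Ioo (0 : ℝ) T)).prod (volume : Measure (UnitAddTorus (Fin 2)))) :=
    measurable_vbar.aestronglyMeasurable
  have hwmS : AEStronglyMeasurable (uncurry w)
      ((volume.restrict (Ioo (0 : ℝ) T)).prod (volume : Measure (UnitAddTorus (Fin 2)))) := by
    rw [restrict_prod_volume_eq]
    exact hwm.restrict
  have hvm : AEStronglyMeasurable (uncurry fun t x => vbar t x + w t x)
      ((volume.restrict (Ioo (0 : ℝ) T)).prod (volume : Measure (UnitAddTorus (Fin 2)))) := hvbm.add hwmS
  -- `L²` slices and uniform bounds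
  have hvb2 : ∀ t ∈ Ioo (0 : ℝ) T, MemLp (vbar t) 2 volume := fun t _ => memLp_vbar t
  have hw2' : ∀ t ∈ Ioo (0 : ℝ) T, MemLp (w t) 2 volume := fun t _ => hw2 t
  have hv2 : ∀ t ∈ Ioo (0 : ℝ) T, MemLp (fun x => vbar t x + w t x) 2 volume :=
    fun t _ => (memLp_vbar t).add (hw2 t)
  have hCvb : ∀ t ∈ Ioo (0 : ℝ) T, ∫ x, ‖vbar t x‖ ^ 2 ≤ 1 := by
    intro t _
    calc ∫ x, ‖vbar t x‖ ^ 2 ≤ ∫ _ : UnitAddTorus (Fin 2), (1 : ℝ) := by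
          refine integral_mono ((memLp_vbar t).integrable_norm_pow two_ne_zero) (integrable_const _)
            fun x => ?_
          have h := norm_vbar_le t x
          have h0 := norm_nonneg (vbar t x)
          nlinarith
      _ = 1 := by simp
  have hCw : ∀ t ∈ Ioo (0 : ℝ) T, ∫ x, ‖w t x‖ ^ 2 ≤ C ^ 2 := fun t _ =>
    integral_norm_sq_le_of_ae_bound (hw2 t) (hwC t)
  have hCv : ∀ t ∈ Ioo (0 : ℝ) T, ∫ x, ‖vbar t x + w t x‖ ^ 2 ≤ 2 + 2 * C ^ 2 := by
    intro t ht
    have h1 : Integrable (fun x => ‖vbar t x‖ ^ 2) volume := (memLp_vbar t).integrable_norm_pow two_ne_zero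
    have h2 : Integrable (fun x => ‖w t x‖ ^ 2) volume := (hw2 t).integrable_norm_pow two_ne_zero
    calc ∫ x, ‖vbar t x + w t x‖ ^ 2 ≤ ∫ x, (2 * ‖vbar t x‖ ^ 2 + 2 * ‖w t x‖ ^ 2) := by
          refine integral_mono (((memLp_vbar t).add (hw2 t)).integrable_norm_pow two_ne_zero)
            ((h1.const_mul 2).add (h2.const_mul 2)) fun x => ?_
          have h := norm_add_le (vbar t x) (w t x)
          have ha := norm_nonneg (vbar t x)
          have hb := norm_nonneg (w t x)
          have hs := norm_nonneg (vbar t x + w t x)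
          nlinarith [sq_nonneg (‖vbar t x‖ - ‖w t x‖)]
      _ = 2 * (∫ x, ‖vbar t x‖ ^ 2) + 2 * ∫ x, ‖w t x‖ ^ 2 := by
          rw [integral_add (h1.const_mul 2) (h2.const_mul 2), MeasureTheory.integral_const_mul,
            MeasureTheory.integral_const_mul]
      _ ≤ 2 + 2 * C ^ 2 := by nlinarith [hCvb t ht, hCw t ht]
  -- Step 1: split the weak integrand
  rw [Torus.setIntegral_weakIntegrand_eq_add (U := fun t x => vbar t x + w t x) hvm hv2 hCv hψ]
  -- Step 2: the time-derivative term
  have hA : ∫ t in Ioo (0 : ℝ) T, ∫ x, ⟪vbar t x + w t x, timeDeriv ψ t x⟫_ℝ =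
      (∫ t in Ioo (0 : ℝ) T, ∫ x, ⟪vbar t x, timeDeriv ψ t x⟫_ℝ) +
        ∫ t in Ioo (0 : ℝ) T, ∫ x, ⟪w t x, timeDeriv ψ t x⟫_ℝ := by
    rw [← integral_add (Torus.integrableOn_integral_inner_timeDeriv hvbm hvb2 hCvb hψ)
      (Torus.integrableOn_integral_inner_timeDeriv hwmS hw2' hCw hψ)]
    refine setIntegral_congr_fun measurableSet_Ioo fun t _ => ?_
    rw [← integral_add (Torus.integrable_inner_timeDeriv_slice hψ (memLp_vbar t))
      (Torus.integrable_inner_timeDeriv_slice hψ (hw2 t))]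
    refine integral_congr_ae (ae_of_all _ fun x => ?_)
    exact inner_add_left _ _ _
  -- Step 3: the convective term, on the product `(0,T) × T²`
  have hmem : ∀ᵐ p ∂((volume.restrict (Ioo (0 : ℝ) T)).prod (volume : Measure (UnitAddTorus (Fin 2)))),
      p.1 ∈ Ioo (0 : ℝ) T := by
    rw [restrict_prod_volume_eq]
    filter_upwards [ae_restrict_mem (measurableSet_Ioo.prod MeasurableSet.univ)] with p hp using hp.1
  have hoffμ : ∀ᵐ p ∂((volume.restrict (Ioo (0 : ℝ) T)).prod (volume : Measure (UnitAddTorus (Fin 2)))),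
      p ∉ U → w p.1 p.2 = 0 ∧ z p.1 p.2 = 0 := by
    rw [restrict_prod_volume_eq]; exact ae_restrict_of_ae hoff
  have h6μ : ∀ᵐ p ∂((volume.restrict (Ioo (0 : ℝ) T)).prod (volume : Measure (UnitAddTorus (Fin 2)))),
      p ∈ U → Matrix.vecMulVec (vbar p.1 p.2 + w p.1 p.2) (vbar p.1 p.2 + w p.1 p.2) -
        (ubar p.1 p.2 + z p.1 p.2) = (ebar ε c p.1 p.2) • (1 : Matrix (Fin 2) (Fin 2) ℝ) := by
    rw [restrict_prod_volume_eq]; exact ae_restrict_of_ae h6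
  have hzCμ : ∀ i j, ∀ᵐ p ∂((volume.restrict (Ioo (0 : ℝ) T)).prod (volume : Measure (UnitAddTorus (Fin 2)))),
      |z p.1 p.2 i j| ≤ C := fun i j => by
    rw [restrict_prod_volume_eq]; exact ae_restrict_of_ae (hzC i j)
  -- the constitutive identity `v ⊗ v = ū + ũ + ē Id` a.e.
  have hmat : ∀ᵐ p ∂((volume.restrict (Ioo (0 : ℝ) T)).prod (volume : Measure (UnitAddTorus (Fin 2)))),
      Matrix.vecMulVec (vbar p.1 p.2 + w p.1 p.2) (vbar p.1 p.2 + w p.1 p.2) =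
        ubar p.1 p.2 + z p.1 p.2 + (ebar ε c p.1 p.2) • (1 : Matrix (Fin 2) (Fin 2) ℝ) := by
    filter_upwards [hmem, hoffμ, h6μ] with p hp hoffp h6p
    by_cases hU : p ∈ U
    · have h := h6p hU
      rw [sub_eq_iff_eq_add] at h
      rw [h, add_comm]
    · obtain ⟨hw0, hz0⟩ := hoffp hU
      have h := vecMulVec_sub_ubar_of_not_mem_U (ε := ε) (c := c) hp.1 (lt_of_lt_of_le hp.2 hT1) hU
      rw [sub_eq_iff_eq_add] at h
      rw [hw0, hz0, add_zero, add_zero, h, add_comm]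
  -- the three space–time integrands
  set G₀ : ℝ × UnitAddTorus (Fin 2) → ℝ := fun p =>
    ⟪vbar p.1 p.2 + w p.1 p.2, convect (fun y => vbar p.1 y + w p.1 y) (ψ p.1) p.2⟫_ℝ with hG₀
  set G₁ : ℝ × UnitAddTorus (Fin 2) → ℝ := fun p =>
    ∑ i, ∑ j, ubar p.1 p.2 i j * Torus.fderiv (ψ p.1) p.2 (EuclideanSpace.single j 1) i with hG₁
  set G₂ : ℝ × UnitAddTorus (Fin 2) → ℝ := fun p =>
    ∑ i, ∑ j, z p.1 p.2 i j * Torus.fderiv (ψ p.1) p.2 (EuclideanSpace.single j 1) i with hG₂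
  have hG0eq : ∀ᵐ p ∂((volume.restrict (Ioo (0 : ℝ) T)).prod (volume : Measure (UnitAddTorus (Fin 2)))),
      G₀ p = G₁ p + G₂ p := by
    filter_upwards [hmat] with p hp
    have hC1 : IsContDiff 1 (ψ p.1) := (hψ.isSmooth_slice p.1).isContDiff (by simp)
    have hF : ∑ i, (Torus.partialDeriv i (ψ p.1) p.2) i = 0 := by
      have h := hdiv p.1 p.2
      rw [divergence_eq_sum_fderiv hC1] at h
      simp_rw [Torus.partialDeriv_eq_fderiv_apply hC1]
      exact h
    simp only [hG₀, hG₁, hG₂]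
    rw [Torus.inner_convect_eq_sum (v := fun y => vbar p.1 y + w p.1 y) hC1 p.2,
      sum_mul_inner_eq_of_vecMulVec_eq (F := fun j => Torus.partialDeriv j (ψ p.1) p.2) hF hp]
    simp_rw [Torus.partialDeriv_eq_fderiv_apply hC1]
  -- measurability of the two right-hand integrands
  have hFc : ∀ j i, Continuous (uncurry fun t x => Torus.fderiv (ψ t) x (EuclideanSpace.single j 1) i) :=
    fun j i => continuous_uncurry_fderiv_apply hψ j i
  have hG1m : AEStronglyMeasurable G₁ ((volume.restrict (Ioo (0 : ℝ) T)).prod (volume : Measure (UnitAddTorus (Fin 2)))) := by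
    refine Finset.aestronglyMeasurable_fun_sum _ fun i _ => Finset.aestronglyMeasurable_fun_sum _ fun j _ => ?_
    exact ((measurable_ubar i j).aestronglyMeasurable).mul (hFc j i).aestronglyMeasurable
  have hG2m : AEStronglyMeasurable G₂ ((volume.restrict (Ioo (0 : ℝ) T)).prod (volume : Measure (UnitAddTorus (Fin 2)))) := by
    refine Finset.aestronglyMeasurable_fun_sum _ fun i _ => Finset.aestronglyMeasurable_fun_sum _ fun j _ => ?_
    have hz : AEStronglyMeasurable (fun p : ℝ × UnitAddTorus (Fin 2) => z p.1 p.2 i j)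
        ((volume.restrict (Ioo (0 : ℝ) T)).prod (volume : Measure (UnitAddTorus (Fin 2)))) := by
      rw [restrict_prod_volume_eq]; exact (hzm i j).restrict
    exact hz.mul (hFc j i).aestronglyMeasurable
  -- bounds
  have hG1b : ∀ᵐ p ∂((volume.restrict (Ioo (0 : ℝ) T)).prod (volume : Measure (UnitAddTorus (Fin 2)))),
      ‖G₁ p‖ ≤ 4 * (1 / 2 * M) := by
    filter_upwards [hmem] with p hp
    simp only [hG₁, Real.norm_eq_abs]
    have hterm : ∀ i j, |ubar p.1 p.2 i j * Torus.fderiv (ψ p.1) p.2 (EuclideanSpace.single j 1) i| ≤ 1 / 2 * M := by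
      intro i j
      rw [abs_mul]
      exact mul_le_mul (abs_ubar_le p.1 p.2 i j) (hM p.1 (hIo hp) p.2 j i) (abs_nonneg _) (by norm_num)
    calc |∑ i, ∑ j, ubar p.1 p.2 i j * Torus.fderiv (ψ p.1) p.2 (EuclideanSpace.single j 1) i|
        ≤ ∑ i, |∑ j, ubar p.1 p.2 i j * Torus.fderiv (ψ p.1) p.2 (EuclideanSpace.single j 1) i| :=
          Finset.abs_sum_le_sum_abs _ _
      _ ≤ ∑ i, ∑ j, |ubar p.1 p.2 i j * Torus.fderiv (ψ p.1) p.2 (EuclideanSpace.single j 1) i| :=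
          Finset.sum_le_sum fun i _ => Finset.abs_sum_le_sum_abs _ _
      _ ≤ ∑ _i : Fin 2, ∑ _j : Fin 2, 1 / 2 * M := Finset.sum_le_sum fun i _ => Finset.sum_le_sum fun j _ => hterm i j
      _ = 4 * (1 / 2 * M) := by
          simp only [Finset.sum_const, Finset.card_univ, Fintype.card_fin]; ring
  have hG2b : ∀ᵐ p ∂((volume.restrict (Ioo (0 : ℝ) T)).prod (volume : Measure (UnitAddTorus (Fin 2)))),
      ‖G₂ p‖ ≤ 4 * (C * M) := by
    filter_upwards [hmem, hzCμ 0 0, hzCμ 0 1, hzCμ 1 0, hzCμ 1 1] with p hp h00 h01 h10 h11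
    have hzall : ∀ i j, |z p.1 p.2 i j| ≤ C := by
      intro i j
      fin_cases i <;> fin_cases j
      · exact h00
      · exact h01
      · exact h10
      · exact h11
    simp only [hG₂, Real.norm_eq_abs]
    have hterm : ∀ i j, |z p.1 p.2 i j * Torus.fderiv (ψ p.1) p.2 (EuclideanSpace.single j 1) i| ≤ C * M := by
      intro i j
      rw [abs_mul]
      have hC0 : 0 ≤ C := (abs_nonneg _).trans (hzall i j)
      exact mul_le_mul (hzall i j) (hM p.1 (hIo hp) p.2 j i) (abs_nonneg _) hC0
    calc |∑ i, ∑ j, z p.1 p.2 i j * Torus.fderiv (ψ p.1) p.2 (EuclideanSpace.single j 1) i|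
        ≤ ∑ i, |∑ j, z p.1 p.2 i j * Torus.fderiv (ψ p.1) p.2 (EuclideanSpace.single j 1) i| :=
          Finset.abs_sum_le_sum_abs _ _
      _ ≤ ∑ i, ∑ j, |z p.1 p.2 i j * Torus.fderiv (ψ p.1) p.2 (EuclideanSpace.single j 1) i| :=
          Finset.sum_le_sum fun i _ => Finset.abs_sum_le_sum_abs _ _
      _ ≤ ∑ _i : Fin 2, ∑ _j : Fin 2, C * M := Finset.sum_le_sum fun i _ => Finset.sum_le_sum fun j _ => hterm i j
      _ = 4 * (C * M) := by
          simp only [Finset.sum_const, Finset.card_univ, Fintype.card_fin]; ring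
  have hG1i : Integrable G₁ ((volume.restrict (Ioo (0 : ℝ) T)).prod (volume : Measure (UnitAddTorus (Fin 2)))) :=
    integrable_prod_of_norm_le hG1m hG1b
  have hG2i : Integrable G₂ ((volume.restrict (Ioo (0 : ℝ) T)).prod (volume : Measure (UnitAddTorus (Fin 2)))) :=
    integrable_prod_of_norm_le hG2m hG2b
  have hG0i : Integrable G₀ ((volume.restrict (Ioo (0 : ℝ) T)).prod (volume : Measure (UnitAddTorus (Fin 2)))) :=
    (hG1i.add hG2i).congr (by filter_upwards [hG0eq] with p hp; simp [hp])
  have e0 : ∫ p, G₀ p ∂((volume.restrict (Ioo (0 : ℝ) T)).prod (volume : Measure (UnitAddTorus (Fin 2)))) =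
      ∫ t in Ioo (0 : ℝ) T, ∫ x, ⟪vbar t x + w t x, convect (fun y => vbar t y + w t y) (ψ t) x⟫_ℝ :=
    integral_prod _ hG0i
  have e1 : ∫ p, G₁ p ∂((volume.restrict (Ioo (0 : ℝ) T)).prod (volume : Measure (UnitAddTorus (Fin 2)))) =
      ∫ t in Ioo (0 : ℝ) T, ∫ x, ∑ i, ∑ j, ubar t x i j * Torus.fderiv (ψ t) x (EuclideanSpace.single j 1) i :=
    integral_prod _ hG1i
  have e2 : ∫ p, G₂ p ∂((volume.restrict (Ioo (0 : ℝ) T)).prod (volume : Measure (UnitAddTorus (Fin 2)))) =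
      ∫ t in Ioo (0 : ℝ) T, ∫ x, ∑ i, ∑ j, z t x i j * Torus.fderiv (ψ t) x (EuclideanSpace.single j 1) i :=
    integral_prod _ hG2i
  have hB : ∫ t in Ioo (0 : ℝ) T, ∫ x, ⟪vbar t x + w t x, convect (fun y => vbar t y + w t y) (ψ t) x⟫_ℝ =
      (∫ t in Ioo (0 : ℝ) T, ∫ x, ∑ i, ∑ j, ubar t x i j * Torus.fderiv (ψ t) x (EuclideanSpace.single j 1) i) +
        ∫ t in Ioo (0 : ℝ) T, ∫ x, ∑ i, ∑ j, z t x i j * Torus.fderiv (ψ t) x (EuclideanSpace.single j 1) i := by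
    rw [← e0, ← e1, ← e2, integral_congr_ae hG0eq, integral_add hG1i hG2i]
  -- Step 4: the subsolution identity, without the pressure term (`div ψ = 0`)
  have hIubar_slice : ∀ t, Integrable (fun x => ∑ i, ∑ j, ubar t x i j *
      Torus.fderiv (ψ t) x (EuclideanSpace.single j 1) i) volume := fun t =>
    integrable_finsetSum _ fun i _ => integrable_finsetSum _ fun j _ => integrable_ubar_mul_fderiv hψ1 t i j
  have hIubar_time : IntegrableOn (fun t => ∫ x, ∑ i, ∑ j, ubar t x i j *
      Torus.fderiv (ψ t) x (EuclideanSpace.single j 1) i) (Ioo (0 : ℝ) T) volume := hG1i.integral_prod_left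
  have hS' : (∫ t in Ioo (0 : ℝ) T, ∫ x, ⟪vbar t x, timeDeriv ψ t x⟫_ℝ) +
      ∫ t in Ioo (0 : ℝ) T, ∫ x, ∑ i, ∑ j, ubar t x i j * Torus.fderiv (ψ t) x (EuclideanSpace.single j 1) i =
      -∫ x, ⟪vortexSheetData x, ψ 0 x⟫_ℝ := by
    rw [← momentum_identity_of_le_one hT1 hψ,
      ← integral_add (Torus.integrableOn_integral_inner_timeDeriv hvbm hvb2 hCvb hψ) hIubar_time]
    refine setIntegral_congr_fun measurableSet_Ioo fun t _ => ?_
    rw [← integral_add (Torus.integrable_inner_timeDeriv_slice hψ (memLp_vbar t)) (hIubar_slice t)]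
    refine integral_congr_ae (ae_of_all _ fun x => ?_)
    show ⟪vbar t x, timeDeriv ψ t x⟫_ℝ + ∑ i, ∑ j, ubar t x i j * Torus.fderiv (ψ t) x (EuclideanSpace.single j 1) i =
      ⟪vbar t x, timeDeriv ψ t x⟫_ℝ + ∑ i, ∑ j, ubar t x i j * Torus.fderiv (ψ t) x (EuclideanSpace.single j 1) i +
        qbar t x * divergence (ψ t) x
    rw [hdiv t x, mul_zero, add_zero]
  -- Step 5: the linear system of the perturbation, on `(0, T)`
  have hL' : ∫ t in Ioo (0 : ℝ) T, ∫ x, (⟪w t x, timeDeriv ψ t x⟫_ℝ +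
      ∑ i, ∑ j, z t x i j * Torus.fderiv (ψ t) x (EuclideanSpace.single j 1) i) = 0 := by
    refine Eq.trans ?_ (hlin ψ hψ.1)
    symm
    obtain ⟨T', hT', h0⟩ := hψ.2
    refine setIntegral_eq_of_subset_of_forall_sdiff_eq_zero measurableSet_Ioo
      (Ioo_subset_Ioo_right hT1) fun t ht => ?_
    have hTt : T' < t := by
      rcases ht with ⟨ht1, ht2⟩
      by_contra h
      exact ht2 ⟨ht1.1, lt_of_le_of_lt (not_lt.1 h) hT'⟩
    have hzero : ∀ x : UnitAddTorus (Fin 2), ⟪w t x, timeDeriv ψ t x⟫_ℝ +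
        ∑ i, ∑ j, z t x i j * Torus.fderiv (ψ t) x (EuclideanSpace.single j 1) i = 0 := by
      intro x
      rw [timeDeriv_eq_zero_of_lt h0 hTt, h0 t hTt.le, fderiv_zero_field]
      simp
    simp_rw [hzero]
    exact integral_zero _ _
  have hIz_time : IntegrableOn (fun t => ∫ x, ∑ i, ∑ j, z t x i j *
      Torus.fderiv (ψ t) x (EuclideanSpace.single j 1) i) (Ioo (0 : ℝ) T) volume := hG2i.integral_prod_left
  have hIz_slice : ∀ᵐ t ∂(volume.restrict (Ioo (0 : ℝ) T)), Integrable (fun x => ∑ i, ∑ j, z t x i j *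
      Torus.fderiv (ψ t) x (EuclideanSpace.single j 1) i) volume := hG2i.prod_right_ae
  have hL'' : (∫ t in Ioo (0 : ℝ) T, ∫ x, ⟪w t x, timeDeriv ψ t x⟫_ℝ) +
      ∫ t in Ioo (0 : ℝ) T, ∫ x, ∑ i, ∑ j, z t x i j * Torus.fderiv (ψ t) x (EuclideanSpace.single j 1) i = 0 := by
    refine Eq.trans ?_ hL'
    rw [← integral_add (Torus.integrableOn_integral_inner_timeDeriv hwmS hw2' hCw hψ) hIz_time]
    refine integral_congr_ae ?_
    filter_upwards [hIz_slice] with t ht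
    rw [← integral_add (Torus.integrable_inner_timeDeriv_slice hψ (hw2 t)) ht]
  -- Step 6: assemble
  rw [hA, hB]
  linarith

end WeakIdentity


/-! ## The prescribed energy on every time slice -/

section SliceEnergy

variable {ε c t : ℝ} {w : ℝ → (UnitAddTorus (Fin 2)) → (EuclideanSpace ℝ (Fin 2))}
  {z : ℝ → (UnitAddTorus (Fin 2)) → Matrix (Fin 2) (Fin 2) ℝ}

/-- **`½|v(t,x)|² = ē(t,x)` for a.e. `x`, at every time `0 < t < 1`** ((6)–(7) of Székelyhidi 2011
on the slice of `U`, and (8) off it, where `ṽ(t) = 0`). [cite: Szekelyhidi2011, (6)–(8)] -/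
theorem ae_norm_sq_eq_two_mul_ebar (ht : 0 < t) (ht1 : t < 1)
    (hztr : ∀ x, (z t x).trace = 0)
    (hoffs : ∀ᵐ x : UnitAddTorus (Fin 2), (t, x) ∉ U → w t x = 0)
    (h6s : ∀ᵐ x : UnitAddTorus (Fin 2), (t, x) ∈ U →
      Matrix.vecMulVec (vbar t x + w t x) (vbar t x + w t x) - (ubar t x + z t x) =
        (ebar ε c t x) • (1 : Matrix (Fin 2) (Fin 2) ℝ)) :
    ∀ᵐ x : UnitAddTorus (Fin 2), ‖vbar t x + w t x‖ ^ 2 = 2 * ebar ε c t x := by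
  filter_upwards [hoffs, h6s] with x hx1 hx2
  by_cases hU : (t, x) ∈ U
  · refine norm_sq_eq_two_mul_of_vecMulVec_sub_eq (M := ubar t x + z t x) ?_ (hx2 hU)
    rw [Matrix.trace_add, trace_ubar, hztr x, add_zero]
  · rw [hx1 hU, add_zero]
    exact norm_vbar_sq_eq_two_mul_ebar_of_not_mem_U ht ht1 hU

/-- `2ē(t)` is integrable on `T²` (bounded and measurable). [folklore] -/
theorem integrable_two_mul_ebar (hεc : |ε| + |c| ≤ 1) (t : ℝ) :
    Integrable (fun x : UnitAddTorus (Fin 2) => 2 * ebar ε c t x) volume := by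
  have hm : Measurable (fun x : UnitAddTorus (Fin 2) => 2 * ebar ε c t x) :=
    ((measurable_ebar ε c).comp (measurable_const.prodMk measurable_id)).const_mul 2
  refine integrable_of_abs_le (f := fun x => 2 * ebar ε c t x) hm (C := 3 / 2) fun x => ?_
  have h1 := quarter_le_ebar hεc t x
  have h2 := ebar_le hεc t x
  rw [abs_of_nonneg (by linarith)]
  linarith

/-- **The energy on every time slice**: `∫ |v(t)|² = ∫ 2ē(t) = 1 - εt/3` for `0 < t < 1`
(Székelyhidi 2011, Remarks: "The kinetic energy is given by `E(t) = ∫ ē dx`", (12)).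
[cite: Szekelyhidi2011, (7), (12)] -/
theorem lintegral_enorm_sq_vbar_add (hεc : |ε| + |c| ≤ 1) (ht : 0 < t) (ht1 : t < 1)
    (hztr : ∀ x, (z t x).trace = 0)
    (hoffs : ∀ᵐ x : UnitAddTorus (Fin 2), (t, x) ∉ U → w t x = 0)
    (h6s : ∀ᵐ x : UnitAddTorus (Fin 2), (t, x) ∈ U →
      Matrix.vecMulVec (vbar t x + w t x) (vbar t x + w t x) - (ubar t x + z t x) =
        (ebar ε c t x) • (1 : Matrix (Fin 2) (Fin 2) ℝ)) :
    ∫⁻ x, ‖vbar t x + w t x‖ₑ ^ 2 = ENNReal.ofReal (1 - ε * t / 3) := by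
  have hpt := ae_norm_sq_eq_two_mul_ebar ht ht1 hztr hoffs h6s
  have hnn : 0 ≤ᵐ[volume] fun x : UnitAddTorus (Fin 2) => 2 * ebar ε c t x :=
    ae_of_all _ fun x => by have := quarter_le_ebar hεc t x; positivity
  calc ∫⁻ x, ‖vbar t x + w t x‖ₑ ^ 2 = ∫⁻ x, ENNReal.ofReal (‖vbar t x + w t x‖ ^ 2) :=
        lintegral_congr fun x => by rw [← ofReal_norm, ENNReal.ofReal_pow (norm_nonneg _)]
    _ = ∫⁻ x, ENNReal.ofReal (2 * ebar ε c t x) := by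
        refine lintegral_congr_ae ?_
        filter_upwards [hpt] with x hx
        rw [hx]
    _ = ENNReal.ofReal (∫ x, 2 * ebar ε c t x) :=
        (ofReal_integral_eq_lintegral_ofReal (integrable_two_mul_ebar hεc t) hnn).symm
    _ = ENNReal.ofReal (1 - ε * t / 3) := by rw [integral_two_mul_ebar ht ht1.le]

end SliceEnergy

/-! ## The wild solutions: one admissible weak Euler solution per parameter pair -/

section OneSolution

variable {ε c C : ℝ} {w : ℝ → (UnitAddTorus (Fin 2)) → (EuclideanSpace ℝ (Fin 2))}
  {z : ℝ → (UnitAddTorus (Fin 2)) → Matrix (Fin 2) (Fin 2) ℝ}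

/-- **The energy profile of `v = v̄ + ṽ` on `[0, ½]`**: `∫ |v(t)|² = 1 - εt/3` for every
`t ∈ [0, ½]` (at `t = 0`, `v(0) = v₀` a.e. and `∫|v₀|² = 1`). [cite: Szekelyhidi2011, (12)] -/
theorem lintegral_enorm_sq_vbar_add_of_mem_Icc (hεc : |ε| + |c| ≤ 1)
    (hztr : ∀ t x, (z t x).trace = 0)
    (hoffs : ∀ t, ∀ᵐ x : UnitAddTorus (Fin 2), (t, x) ∉ U → w t x = 0)
    (h6s : ∀ t, ∀ᵐ x : UnitAddTorus (Fin 2), (t, x) ∈ U →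
      Matrix.vecMulVec (vbar t x + w t x) (vbar t x + w t x) - (ubar t x + z t x) =
        (ebar ε c t x) • (1 : Matrix (Fin 2) (Fin 2) ℝ))
    {t : ℝ} (ht : t ∈ Icc (0 : ℝ) (1 / 2)) :
    ∫⁻ x, ‖vbar t x + w t x‖ₑ ^ 2 = ENNReal.ofReal (1 - ε * t / 3) := by
  rcases eq_or_lt_of_le ht.1 with h0 | hpos
  · -- `t = 0`: the datum
    subst h0
    have hae : (fun x => vbar 0 x + w 0 x) =ᵐ[volume] vortexSheetData := by
      filter_upwards [hoffs 0] with x hx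
      rw [hx (fun h => lt_irrefl (0 : ℝ) h.1), add_zero, vbar_zero]
    rw [mul_zero, zero_div, sub_zero, ENNReal.ofReal_one, ← lintegral_enorm_sq_vortexSheetData]
    exact lintegral_congr_ae (hae.mono fun x hx => by dsimp only at hx ⊢; rw [hx])
  · exact lintegral_enorm_sq_vbar_add hεc hpos (by linarith [ht.2]) (hztr t) (hoffs t) (h6s t)

/-- **`v(0) = v₀` a.e.** (`ṽ(0) = 0` a.e. since the slice `t = 0` misses `U`, and `v̄(0) = v₀`).
[cite: Szekelyhidi2011, Thm. 1.4 ("v̄(0) = v₀")] -/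
theorem vbar_add_zero_ae_eq (hoffs : ∀ t, ∀ᵐ x : UnitAddTorus (Fin 2), (t, x) ∉ U → w t x = 0) :
    (fun x => vbar 0 x + w 0 x) =ᵐ[volume] vortexSheetData := by
  filter_upwards [hoffs 0] with x hx
  rw [hx (fun h => lt_irrefl (0 : ℝ) h.1), add_zero, vbar_zero]

/-- **`v = v̄ + ṽ` is essentially bounded on `(0,T) × T²`** (as a field on `ℝ × ℝ²` through the
covering map): `|v̄| ≤ 1` and `|ṽ| ≤ C` a.e. [cite: Szekelyhidi2011, Thm. 1.1 ("v ∈ L^∞")] -/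
theorem memLp_top_stLift_vbar_add (T : ℝ)
    (hwm : AEStronglyMeasurable (uncurry w) (volume : Measure (ℝ × UnitAddTorus (Fin 2))))
    (hwC : ∀ t, ∀ᵐ x : UnitAddTorus (Fin 2), ‖w t x‖ ≤ C) :
    MemLp (stLift fun t x => vbar t x + w t x) ∞
      (volume.restrict (Ioo (0 : ℝ) T ×ˢ (univ : Set (EuclideanSpace ℝ (Fin 2))))) := by
  have hwmS : AEStronglyMeasurable (uncurry w)
      ((volume.restrict (Ioo (0 : ℝ) T)).prod (volume : Measure (UnitAddTorus (Fin 2)))) := by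
    rw [restrict_prod_volume_eq]
    exact hwm.restrict
  have hvm : AEStronglyMeasurable (uncurry fun t x => vbar t x + w t x)
      ((volume.restrict (Ioo (0 : ℝ) T)).prod (volume : Measure (UnitAddTorus (Fin 2)))) :=
    (measurable_vbar.aestronglyMeasurable).add hwmS
  have hst := Torus.aestronglyMeasurable_stLift_of_uncurry hvm
  refine memLp_top_of_bound hst (1 + C) (ae_restrict_of_ae ?_)
  -- the bound on all of `ℝ × ℝ²`, pulled back along the covering map
  have hb : ∀ᵐ p : ℝ × UnitAddTorus (Fin 2), ‖vbar p.1 p.2 + w p.1 p.2‖ ≤ 1 + C := by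
    filter_upwards [ae_prod_norm_le_of_forall_ae hwm hwC] with p hp
    exact (norm_add_le _ _).trans (add_le_add (norm_vbar_le p.1 p.2) hp)
  have hq : Measure.QuasiMeasurePreserving (Prod.map id proj : ℝ × EuclideanSpace ℝ (Fin 2) → ℝ × UnitAddTorus (Fin 2))
      volume volume := by
    rw [Measure.volume_eq_prod, Measure.volume_eq_prod]
    exact MeasureTheory.QuasiMeasurePreserving.prodMap (Measure.QuasiMeasurePreserving.id _)
      Torus.quasiMeasurePreserving_proj
  have h := ae_of_ae_map hq.aemeasurable (hq.ae_map_le hb)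
  filter_upwards [h] with p hp
  exact hp

/-- **Weak incompressibility of `v(t) = v̄(t) + ṽ(t)`** for every `t`. [cite: Szekelyhidi2011, (3)] -/
theorem isWeaklyDivFree_vbar_add {t : ℝ} (hw2 : MemLp (w t) 2 volume) (hwdiv : IsWeaklyDivFree (w t)) :
    IsWeaklyDivFree fun x => vbar t x + w t x := by
  intro θ hθ
  have h1 : Integrable (fun x => ⟪vbar t x, Torus.gradient θ x⟫_ℝ) volume :=
    Literature.Analysis.FluidPDE.Torus.integrable_inner_of_memLp_two (memLp_vbar t) (hθ.gradient.memLp 2)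
  have h2 : Integrable (fun x => ⟪w t x, Torus.gradient θ x⟫_ℝ) volume :=
    Literature.Analysis.FluidPDE.Torus.integrable_inner_of_memLp_two hw2 (hθ.gradient.memLp 2)
  simp_rw [inner_add_left]
  rw [integral_add h1 h2, isWeaklyDivFree_vbar t θ hθ, hwdiv θ hθ, add_zero]

/-- **Weak continuity of `v = v̄ + ṽ` into `L²`.** [cite: Szekelyhidi2011, Thm. 1.3 ("ṽ ∈ C(ℝ; L²_w)")] -/
theorem continuous_integral_inner_vbar_add (hw2 : ∀ t, MemLp (w t) 2 volume)
    (hwc : ∀ g : UnitAddTorus (Fin 2) → EuclideanSpace ℝ (Fin 2), MemLp g 2 volume →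
      Continuous fun t => ∫ x, ⟪w t x, g x⟫_ℝ)
    {g : UnitAddTorus (Fin 2) → EuclideanSpace ℝ (Fin 2)} (hg : MemLp g 2 volume) :
    Continuous fun t => ∫ x, ⟪vbar t x + w t x, g x⟫_ℝ := by
  have h : (fun t => ∫ x, ⟪vbar t x + w t x, g x⟫_ℝ) =
      fun t => (∫ x, ⟪vbar t x, g x⟫_ℝ) + ∫ x, ⟪w t x, g x⟫_ℝ := by
    funext t
    simp_rw [inner_add_left]
    exact integral_add (Literature.Analysis.FluidPDE.Torus.integrable_inner_of_memLp_two (memLp_vbar t) hg)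
      (Literature.Analysis.FluidPDE.Torus.integrable_inner_of_memLp_two (hw2 t) hg)
  rw [h]
  exact (continuous_integral_inner_vbar hg).add (hwc g hg)

end OneSolution

end VortexSheet

/-! ## Theorem 1.1 from Theorem 1.3 -/

open VortexSheet in
/-- **Székelyhidi's vortex-sheet theorem (Thm. 1.1) from his localized convex-integration theorem
(Thm. 1.3)** — the printed proof of Thm. 1.1 (Székelyhidi, C. R. Math. 349 (2011), Thm. 1.4 and
§2): the explicit triple `(v̄, ū, q̄)` of §2 is a subsolution with respect to
`ē = ½ - κ(1 - α²)` (`VortexSheet.isEulerSubsolutionOn`), continuous and strict on the turbulent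
zone `U`; Thm. 1.3 (`Torus.Szekelyhidi2011_thm13`) supplies a perturbation `(ṽ, ũ)` supported in
`U` with `(v̄ + ṽ) ⊗ (v̄ + ṽ) - (ū + ũ) = ē Id` in `U` (on every time slice); then `v = v̄ + ṽ` is
a weak solution of Euler with datum `v₀` (`VortexSheet.weakIdentity_vbar_add`), weakly continuous
into `L²`, with `∫|v(t)|² = ∫2ē(t) = 1 - εt/3` for every `t` (`lintegral_enorm_sq_vbar_add_of_mem_Icc`);
`ε = 0` and the modulations `c ∈ (-1, 1)` give infinitely many energy-conserving solutions
(distinct by `VortexSheet.eq_of_ebar_zero_ae_eq`), `ε ∈ (0, 1)`, `c = 0` infinitely many with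
strictly decreasing energy, all admissible; here on `T² × [0, ½]`.
[cite: Szekelyhidi2011, Thm. 1.1, Thm. 1.3, Thm. 1.4, §2] -/
theorem Szekelyhidi2011_thm11_of_thm13
    (h13 : Literature.Analysis.FluidPDE.Torus.Szekelyhidi2011_thm13) : Szekelyhidi2011_thm11 := by
  -- Step 0: one perturbation per admissible parameter pair `q = (ε, c)`
  have hex := fun (q : ℝ × ℝ) (hq : |q.1| + |q.2| < 1) =>
    h13 1 (ebar q.1 q.2) vbar ubar qbar U (isEulerSubsolutionOn hq.le) isOpen_U U_subset
      (continuousOn_ebar q.1 q.2) continuousOn_vbar continuousOn_ubar continuousOn_qbar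
      ⟨3 / 4, fun p _ => ebar_le hq.le p.1 p.2⟩ (fun p hp => defect_posDef hq hp)
  choose! W Z hWZ using hex
  -- the solutions and the parameter families
  set sol : ℝ × ℝ → ℝ → UnitAddTorus (Fin 2) → EuclideanSpace ℝ (Fin 2) :=
    fun q t x => vbar t x + W q t x with hsol
  set P₁ : Set (ℝ × ℝ) := (fun c' : ℝ => ((0 : ℝ), c')) '' Ioo (-1 : ℝ) 1 with hP₁
  set P₂ : Set (ℝ × ℝ) := (fun ε' : ℝ => (ε', (0 : ℝ))) '' Ioo (0 : ℝ) 1 with hP₂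
  have hP₁mem : ∀ q ∈ P₁, q.1 = 0 ∧ |q.1| + |q.2| < 1 := by
    rintro q ⟨c', hc', rfl⟩
    exact ⟨rfl, by simpa [abs_lt] using hc'⟩
  have hP₂mem : ∀ q ∈ P₂, 0 < q.1 ∧ q.2 = 0 ∧ |q.1| + |q.2| < 1 := by
    rintro q ⟨ε', hε', rfl⟩
    refine ⟨hε'.1, rfl, ?_⟩
    simp only [abs_zero, add_zero]
    rw [abs_of_pos hε'.1]
    exact hε'.2
  have hPmem : ∀ q ∈ P₁ ∪ P₂, 0 ≤ q.1 ∧ |q.1| + |q.2| < 1 := by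
    rintro q (hq | hq)
    · obtain ⟨h1, h2⟩ := hP₁mem q hq
      exact ⟨h1.symm.le, h2⟩
    · obtain ⟨h1, -, h2⟩ := hP₂mem q hq
      exact ⟨h1.le, h2⟩
  -- Step 1: the energy profile and the datum, for admissible parameters
  have hE : ∀ q : ℝ × ℝ, |q.1| + |q.2| < 1 → ∀ t ∈ Icc (0 : ℝ) (1 / 2),
      ∫⁻ x, ‖sol q t x‖ₑ ^ 2 = ENNReal.ofReal (1 - q.1 * t / 3) := by
    intro q hq t ht
    obtain ⟨-, -, -, hzsym, -, -, -, -, -, hoffs, -, h6s⟩ := hWZ q hq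
    exact lintegral_enorm_sq_vbar_add_of_mem_Icc hq.le (fun t x => (hzsym t x).2) hoffs h6s ht
  have hslice : ∀ q : ℝ × ℝ, |q.1| + |q.2| < 1 → ∀ t ∈ Ioo (0 : ℝ) 1,
      ∀ᵐ x : UnitAddTorus (Fin 2), ‖sol q t x‖ ^ 2 = 2 * ebar q.1 q.2 t x := by
    intro q hq t ht
    obtain ⟨-, -, -, hzsym, -, -, -, -, -, hoffs, -, h6s⟩ := hWZ q hq
    exact ae_norm_sq_eq_two_mul_ebar ht.1 ht.2 (fun x => (hzsym t x).2) (hoffs t) (h6s t)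
  -- Step 2: each solution is admissible, with `L²` slices, bounded
  have hkey : ∀ q : ℝ × ℝ, 0 ≤ q.1 → |q.1| + |q.2| < 1 →
      Literature.Analysis.FluidPDE.Torus.IsAdmissibleWeakEulerOn (1 / 2) vortexSheetData (sol q) ∧
        (∀ t ∈ Icc (0 : ℝ) (1 / 2), MemLp (sol q t) 2 volume) ∧
        MemLp (stLift (sol q)) ∞ (volume.restrict (Ioo (0 : ℝ) (1 / 2) ×ˢ univ)) := by
    intro q hq0 hq
    obtain ⟨hwm, hzm, ⟨C, hwC, hzC⟩, hzsym, hw2, hwc, hlin, hwdiv, hoff, hoffs, h6, h6s⟩ := hWZ q hq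
    have hv2 : ∀ t, MemLp (sol q t) 2 volume := fun t => (memLp_vbar t).add (hw2 t)
    refine ⟨⟨⟨?_, ?_, ?_, fun ψ hψ hdivψ => ?_⟩, vbar_add_zero_ae_eq hoffs, fun g hg =>
      (continuous_integral_inner_vbar_add hw2 hwc hg).continuousOn, fun t ht => ?_⟩,
      fun t _ => hv2 t, memLp_top_stLift_vbar_add (1 / 2) hwm hwC⟩
    · -- measurability
      have hwmS : AEStronglyMeasurable (uncurry (W q))
          ((volume.restrict (Ioo (0 : ℝ) (1 / 2))).prod (volume : Measure (UnitAddTorus (Fin 2)))) := by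
        rw [restrict_prod_volume_eq]
        exact hwm.restrict
      exact Torus.aestronglyMeasurable_stLift_of_uncurry ((measurable_vbar.aestronglyMeasurable).add hwmS)
    · -- `L²` in space–time
      calc ∫⁻ t in Ioo (0 : ℝ) (1 / 2), ∫⁻ x, ‖sol q t x‖ₑ ^ 2
          ≤ ∫⁻ _ in Ioo (0 : ℝ) (1 / 2), 1 := by
            refine setLIntegral_mono' measurableSet_Ioo fun t ht => ?_
            rw [hE q hq t (Ioo_subset_Icc_self ht)]
            exact ENNReal.ofReal_le_one.2 (by nlinarith [ht.1, hq0])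
        _ < ⊤ := by simp
    · -- weakly divergence free
      exact ae_of_all _ fun t => isWeaklyDivFree_vbar_add (hw2 t) (hwdiv t)
    · -- the weak identity
      exact weakIdentity_vbar_add (by norm_num) hwm hzm hwC hzC hw2 hlin hoff h6 hψ hdivψ
    · -- the energy inequality
      rw [hE q hq t ht, lintegral_enorm_sq_vortexSheetData]
      exact ENNReal.ofReal_le_one.2 (by nlinarith [ht.1, hq0])
  -- Step 3: distinct parameters give solutions that differ on the slice `t = ½`
  have hhalf : (1 / 2 : ℝ) ∈ Icc (0 : ℝ) (1 / 2) := ⟨by norm_num, le_rfl⟩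
  have hhalf' : (1 / 2 : ℝ) ∈ Ioo (0 : ℝ) 1 := ⟨by norm_num, by norm_num⟩
  have hε_eq : ∀ q q' : ℝ × ℝ, |q.1| + |q.2| < 1 → |q'.1| + |q'.2| < 1 →
      sol q (1 / 2) =ᵐ[volume] sol q' (1 / 2) → q.1 = q'.1 := by
    intro q q' hq hq' hae
    have h1 := hE q hq (1 / 2) hhalf
    have h2 := hE q' hq' (1 / 2) hhalf
    have h12 : ∫⁻ x, ‖sol q (1 / 2) x‖ₑ ^ 2 = ∫⁻ x, ‖sol q' (1 / 2) x‖ₑ ^ 2 :=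
      lintegral_congr_ae (hae.mono fun x hx => by dsimp only at hx ⊢; rw [hx])
    rw [h1, h2] at h12
    have hb : |q.1| < 1 := by linarith [abs_nonneg q.2]
    have hb' : |q'.1| < 1 := by linarith [abs_nonneg q'.2]
    have hnn : 0 ≤ 1 - q.1 * (1 / 2) / 3 := by linarith [(abs_lt.1 hb).2]
    have hnn' : 0 ≤ 1 - q'.1 * (1 / 2) / 3 := by linarith [(abs_lt.1 hb').2]
    have h := (ENNReal.ofReal_eq_ofReal_iff hnn hnn').1 h12
    linarith
  have hc_eq : ∀ c₁ c₂ : ℝ, |c₁| < 1 → |c₂| < 1 →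
      sol (0, c₁) (1 / 2) =ᵐ[volume] sol (0, c₂) (1 / 2) → c₁ = c₂ := by
    intro c₁ c₂ hc₁ hc₂ hae
    have hq₁ : |((0 : ℝ), c₁).1| + |((0 : ℝ), c₁).2| < 1 := by simpa using hc₁
    have hq₂ : |((0 : ℝ), c₂).1| + |((0 : ℝ), c₂).2| < 1 := by simpa using hc₂
    have h1 := hslice (0, c₁) hq₁ (1 / 2) hhalf'
    have h2 := hslice (0, c₂) hq₂ (1 / 2) hhalf'
    refine eq_of_ebar_zero_ae_eq (t := 1 / 2) (by norm_num) (by norm_num) ?_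
    filter_upwards [hae, h1, h2] with x hx hx1 hx2
    have : 2 * ebar 0 c₁ (1 / 2) x = 2 * ebar 0 c₂ (1 / 2) x := by rw [← hx1, ← hx2, hx]
    linarith
  have hdist : ∀ q ∈ P₁ ∪ P₂, ∀ q' ∈ P₁ ∪ P₂, sol q (1 / 2) =ᵐ[volume] sol q' (1 / 2) → q = q' := by
    intro q hq q' hq' hae
    have h1 := hε_eq q q' (hPmem q hq).2 (hPmem q' hq').2 hae
    rcases hq with hq | hq <;> rcases hq' with hq' | hq'
    · obtain ⟨c₁, hc₁, rfl⟩ := hq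
      obtain ⟨c₂, hc₂, rfl⟩ := hq'
      have := hc_eq c₁ c₂ (abs_lt.2 hc₁) (abs_lt.2 hc₂) hae
      rw [this]
    · exact absurd h1 (by rw [(hP₁mem q hq).1]; exact (ne_of_lt (hP₂mem q' hq').1))
    · exact absurd h1 (by rw [(hP₁mem q' hq').1]; exact (ne_of_gt (hP₂mem q hq).1))
    · obtain ⟨ε₁, hε₁, rfl⟩ := hq
      obtain ⟨ε₂, hε₂, rfl⟩ := hq'
      simp only at h1
      rw [h1]
  have hinj : InjOn sol (P₁ ∪ P₂) := fun q hq q' hq' h =>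
    hdist q hq q' hq' (by rw [h])
  -- Step 4: the families are infinite
  have hP₁inf : P₁.Infinite :=
    (Ioo_infinite (by norm_num : (-1 : ℝ) < 1)).image fun c₁ _ c₂ _ h => by simpa using h
  have hP₂inf : P₂.Infinite :=
    (Ioo_infinite (by norm_num : (0 : ℝ) < 1)).image fun ε₁ _ ε₂ _ h => by simpa using h
  -- Step 5: assemble
  unfold Szekelyhidi2011_thm11
  refine ⟨1 / 2, by norm_num, sol '' (P₁ ∪ P₂), ?_, ?_, ?_, ?_, ?_⟩
  · exact (hP₁inf.mono subset_union_left).image (hinj.mono subset_rfl)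
  · rintro f ⟨q, hq, rfl⟩ g ⟨q', hq', rfl⟩ hne hall
    exact hne (congrArg sol (hdist q hq q' hq' (hall (1 / 2) hhalf)))
  · rintro f ⟨q, hq, rfl⟩
    exact hkey q (hPmem q hq).1 (hPmem q hq).2
  · -- energy-conserving members: the family `P₁`
    have hsub : sol '' P₁ ⊆ {v ∈ sol '' (P₁ ∪ P₂) |
        ∀ t ∈ Icc (0 : ℝ) (1 / 2), ∫⁻ x, ‖v t x‖ₑ ^ 2 = ∫⁻ x, ‖vortexSheetData x‖ₑ ^ 2} := by
      rintro f ⟨q, hq, rfl⟩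
      refine ⟨⟨q, Or.inl hq, rfl⟩, fun t ht => ?_⟩
      rw [hE q (hP₁mem q hq).2 t ht, (hP₁mem q hq).1, lintegral_enorm_sq_vortexSheetData]
      simp
    exact ((hP₁inf.image (hinj.mono subset_union_left)).mono hsub)
  · -- strictly dissipating members: the family `P₂`
    have hsub : sol '' P₂ ⊆ {v ∈ sol '' (P₁ ∪ P₂) |
        StrictAntiOn (fun t => ∫⁻ x, ‖v t x‖ₑ ^ 2) (Icc (0 : ℝ) (1 / 2))} := by
      rintro f ⟨q, hq, rfl⟩
      refine ⟨⟨q, Or.inr hq, rfl⟩, fun s hs t ht hst => ?_⟩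
      obtain ⟨hq0, -, hq⟩ := hP₂mem q hq
      show ∫⁻ x, ‖sol q t x‖ₑ ^ 2 < ∫⁻ x, ‖sol q s x‖ₑ ^ 2
      rw [hE q hq t ht, hE q hq s hs]
      have hb : |q.1| < 1 := by linarith [abs_nonneg q.2]
      refine (ENNReal.ofReal_lt_ofReal_iff ?_).2 ?_
      · nlinarith [hs.2, (abs_lt.1 hb).2]
      · nlinarith
    exact ((hP₂inf.image (hinj.mono subset_union_right)).mono hsub)

end Literature.Barriers.AnomalousDissipation

end
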